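import Mathlib
import Summits.ResolutionOfSingularities.ResolutionOfSingularities.Theorems.RadicialJungCleanModelsCleanProp44PhaseTwoMin
import Summits.ResolutionOfSingularities.ResolutionOfSingularities.Theorems.RadicialJungCleanModelsCleanProp44TauTwoRegimeOffCentre
import Summits.ResolutionOfSingularities.ResolutionOfSingularities.Theorems.RadicialJungCleanModelsCleanDimTwoSlice
import Summits.ResolutionOfSingularities.ResolutionOfSingularities.Theorems.RadicialJungCleanModelsCleanSeqExtension
import Summits.ResolutionOfSingularities.ResolutionOfSingularities.Theorems.RadicialJungCleanModelsModelOfOpenImmersion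
import Summits.ResolutionOfSingularities.ResolutionOfSingularities.Theorems.FrobeniusLadderFInjectiveMacaulayficationProp44TidyPieces
import Literature.AlgebraicGeometry.Resolution.BlowupRestrictOpen
import HarnessLib

/-!
# Route `RadicialJung`, crux `CleanModels` (stmt-ResolutionOfSingularities-15917), line `Sketch` rev 35, stub 6 `stub_cleanProp44` (X44c):
# the clean CURVE slice reduced to its `λ`-MINIMAL curve situations — «working above the generic point» ([CoP1] p. 10) in the clean world

Seat decomp-res-hand-2 g17 (structural hand: «reduce to the most general landed lemma, then specialise»), companion of the twelfth cut
✓ `cleanProp44_of_phaseTwoMin_of_curveTauOneVN : (R1ᵐⁱⁿ) → (R3ᵛⁿ′) → X44c` (`…CleanProp44PhaseTwoMin.lean`), which did for clean Phase II what this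
file does for the curve slice (R3ᵛⁿ′).

Cossart–Piltant settle a permissible curve `Y = cl{η}` of `Σ = {ord ≥ m}` by blowing it up and «working above the generic point `η`»: the colength
`λ = λ(𝒪_{X,η}/J_η)` drops at the near curve `Γ′` over `η` ([ZS] App. 5 = ✓ `IsBlowup.colength_weakTransform_lt`), so an induction on `λ` runs
(tree: ✓ `CP2008Prop44.orderReducible_comap_of_curve_aux`).  In the clean world the blowing up needs the curve to be clean-permissible, and the hands'
census left the curve slice as the hypothesis schema (R3ᵛⁿ′) «curves with a `τ = 1` point that are NOT (clean-permissible everywhere without very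
near point)».  This file states the printed induction in its MOST GENERAL form — strong induction on `λ` over the CURVE SITUATIONS (a regular
irreducible curve `cl{η}` containing the whole `m`-stratum, `ord = m` along it) reachable by clean-permissible sequences — so that the research
content of the curve slice is, BY A KERNEL THEOREM, confined to

  (R3ᵐⁱⁿ) «curve situations of a clean threefold with a `τ = 1` closed threefold point, NOT (clean-permissible along the curve without very near
  point), and `λ`-MINIMAL: no clean-permissible sequence for `(J, m)` and the line of `G` reaches a curve situation of smaller `λ`».

* `exists_isCleanPermissibleSeq_lt_of_top` — bookkeeping: a clean-permissible sequence over the open `⊤` settling `(J|_⊤, m)` is read back over `X`.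
* `exists_isCleanPermissibleSeq_lt_of_curve_of_minimal` — the GLOBAL clean curve slice (the curve contains the whole `m`-stratum of `X`) from the
  schema (R3ᵐⁱⁿ) at the same prime and order; the degenerate closed `η` (✓ coheight-two slice), the `τ ≥ 2` regime (✓) and clean-permissible curves
  without very near point (✓) are settled inside the loop by landed theorems.

The companion `…CleanProp44CurveSliceMinCut.lean` derives the `V`-relative consumer (R3ᵛⁿ′) (transport to the open subscheme, as in
✓ `exists_isCleanPermissibleSeq_lt_comap_of_curve_of_cleanPermissible_of_forall_near_two_le`) and the THIRTEENTH CUT X44c ⟸ (R1ᵐⁱⁿ) ∧ (R3ᵐⁱⁿ).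

Honest framing: OURS; (R3ᵐⁱⁿ) is NOT proved here; nothing here proves X44c, any case of `CleanModels`, or resolution of singularities in
characteristic `p`. [cite: CossartPiltant2008, Prop. 4.4 (proof, pp. 10–11), Lemma 4.3 (2) (4)] [cite: ZariskiSamuel1960, Appendix 5, Thm. 3]
[cite: Piltant2013, §2 Axiom 4, Prop. 5.1 (proof, Step 2)]
-/

noncomputable section

set_option linter.dupNamespace false -- mandated namespace of this single-conjunct summit

open CategoryTheory CategoryTheory.Limits AlgebraicGeometry TopologicalSpace IsLocalRing
open Literature.AlgebraicGeometry.Resolution Literature.AlgebraicGeometry.Motives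
open Scheme.IdealSheafData
open Summit.ResolutionOfSingularities.ResolutionOfSingularities.Theorems.CP2008Prop44

namespace Summit.ResolutionOfSingularities.ResolutionOfSingularities.Theorems.RadicialJung.CleanModels

/-! ## §1 Reading a clean-permissible sequence over the open `⊤` back over the scheme -/

/-- **A clean-permissible sequence over the open subscheme `⊤ ⊆ X` settling `(J|_⊤, m)` gives one over `X` settling `(J, m)`** (relative
extension along the open immersion `⊤ ↪ X`, ✓ `IsCleanPermissibleSeq.exists_extension_of_isOpenImmersion_rel'` with `Z = X`, whose extension is
then covered by the image of the sequence). [cite: Piltant2013, Prop. 5.1 (proof, Step 2)] -/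
theorem exists_isCleanPermissibleSeq_lt_of_top {p : ℕ} {X : Scheme.{0}} [IsIntegral X] [IsNoetherian X] (J : X.IdealSheafData) (m : ℕ)
    (G : X.functionField) [IsIntegral ((⊤ : X.Opens) : Scheme.{0})] [IsDominant (⊤ : X.Opens).ι]
    (h : ∃ (V' : Scheme.{0}) (π : V' ⟶ (⊤ : X.Opens)) (_ : IsIntegral V') (_ : IsDominant π) (K' : V'.IdealSheafData),
      IsCleanPermissibleSeq p π (J.comap (⊤ : X.Opens).ι) m K' (RatFn.functionFieldMap (⊤ : X.Opens).ι G) ∧ ∀ y, idealOrder K' y < m) :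
    ∃ (X' : Scheme.{0}) (π : X' ⟶ X) (_ : IsIntegral X') (_ : IsDominant π) (J' : X'.IdealSheafData),
      IsCleanPermissibleSeq p π J m J' G ∧ ∀ x, idealOrder J' x < m := by
  obtain ⟨V', π, hV', hπ, K', hseq, hlt⟩ := h
  haveI := hV'
  haveI := hπ
  have hext := hseq.exists_extension_of_isOpenImmersion_rel' J m G Set.univ isClosed_univ (⊤ : X.Opens).ι
    (fun y _ => Set.mem_univ _) (fun x _ => by rw [Scheme.Opens.range_ι]; trivial)
  obtain ⟨X', hX', Φ, hΦ, J', u', hseq', hu', -, hK', -, hsurj, -, -, -⟩ := hext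
  refine ⟨X', Φ, hX', hΦ, J', hseq', fun x' => ?_⟩
  obtain ⟨y', rfl⟩ := hsurj x' (Set.mem_univ _)
  haveI := hu'
  have h1 := hlt y'
  rw [hK', idealOrder_comap_of_isOpenImmersion u' J' y'] at h1
  exact h1

/-! ## §2 The global clean curve slice from its `λ`-minimal residual -/

set_option maxHeartbeats 1600000 in
-- long binder lists and a five-way case analysis at every reachable stage
/-- **The clean curve slice (global form) from its `λ`-minimal residual (R3ᵐⁱⁿ).**  `X` integral Noetherian regular quasi-excellent of dimension
`≤ 3`, `char K(X) = p`, the line of `G` clean-regular at every point; `(J, m)` with `m ≥ 1`, `ord ≤ m`, `V(J)` of codimension `≥ 2`; `η` a point with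
regular reduced closure `Y = cl{η}` CONTAINING the whole `m`-stratum, `ord J = m` along `Y`, `codim η = 2`.  Suppose (R3ᵐⁱⁿ) at the prime `p` and the
order `m`: every such CURVE situation (`η` not closed) with a `τ = 1` closed threefold point of order `m`, NOT (clean-permissible along the curve
without very near point), and `λ`-MINIMAL — no clean-permissible sequence reaches a curve situation of smaller `λ = λ(𝒪_{X,η}/J_η)` — is settled by
a clean-permissible sequence.  Then `(J, m)` is settled by a clean-permissible sequence.  Proof: strong induction on `λ` over the curve situations
reachable by clean-permissible sequences («working above the generic point», [CoP1] p. 10): a closed `η` is an isolated coheight-`2` point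
(✓ `exists_isCleanPermissibleSeq_lt_comap_of_isolated_coheight_two` on the open `⊤`, read back by `exists_isCleanPermissibleSeq_lt_of_top`); the
`τ ≥ 2` regime is ✓ `exists_isCleanPermissibleSeq_lt_of_two_le_stalkTau`; a clean-permissible curve without very near point is
✓ `exists_isCleanPermissibleSeq_lt_of_two_le_stalkTau_off_centre`; a detour lowering `λ` recurses (✓ `IsCleanPermissibleSeq.comp`); else (R3ᵐⁱⁿ).
[cite: CossartPiltant2008, Prop. 4.4 (proof, pp. 10–11), Lemma 4.3 (2) (4)] [cite: Piltant2013, §2 Axiom 4] -/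
theorem exists_isCleanPermissibleSeq_lt_of_curve_of_minimal {p : ℕ} (hp : p.Prime) {X : Scheme.{0}} [IsIntegral X] [IsNoetherian X]
    [hcharX : CharP X.functionField p] (hX : Scheme.IsRegular X) (hqe : Scheme.IsQuasiExcellent X) (hX3 : topologicalKrullDim X ≤ 3)
    (G : X.functionField) (hG : ∀ x : X, CleanRegAt p (algebraMap (X.presheaf.stalk x) X.functionField) G)
    (J : X.IdealSheafData) {m : ℕ} (hm : 1 ≤ m) (hle : ∀ z, idealOrder J z ≤ m) (hcodim : ∀ z ∈ J.support, 1 < Order.coheight z)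
    (η : X) (hYreg : Scheme.IsRegular (vanishingIdeal (⟨closure {η}, isClosed_closure⟩ : Closeds X)).subscheme)
    (hstr : ∀ z : X, (m : ℕ∞) ≤ idealOrder J z → z ∈ closure ({η} : Set X))
    (hord : ∀ y ∈ closure ({η} : Set X), idealOrder J y = m) (hcoh : Order.coheight η = 2)
    (hMIN : ∀ {X : Scheme.{0}} [IsIntegral X] [IsNoetherian X], CharP X.functionField p →
      ∀ (hX : Scheme.IsRegular X), Scheme.IsQuasiExcellent X → topologicalKrullDim X ≤ 3 →
      ∀ (G : X.functionField), (∀ x : X, CleanRegAt p (algebraMap (X.presheaf.stalk x) X.functionField) G) →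
      ∀ (J : X.IdealSheafData), (∀ z, idealOrder J z ≤ m) → (∀ z ∈ J.support, 1 < Order.coheight z) →
      ∀ (η : X), ¬ IsClosed ({η} : Set X) →
        Scheme.IsRegular (vanishingIdeal (⟨closure {η}, isClosed_closure⟩ : Closeds X)).subscheme →
        (∀ z : X, (m : ℕ∞) ≤ idealOrder J z → z ∈ closure ({η} : Set X)) →
        (∀ y ∈ closure ({η} : Set X), idealOrder J y = m) →
      -- (τ1) some closed threefold point of order `m` has `τ = 1`
      ¬ (∀ x : X, IsClosed ({x} : Set X) → idealOrder J x = m → (maximalIdeal (X.presheaf.stalk x)).spanFinrank = 3 →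
          ∀ hr : IsRegularLocalRing (X.presheaf.stalk x), 2 ≤ @stalkTau X J x hr m) →
      -- (vn′) NOT (clean-permissible along the curve AND no very near point over it)
      ¬ ((∀ y ∈ closure ({η} : Set X), CleanPermissibleAt p (algebraMap (X.presheaf.stalk y) X.functionField) G
            (stalkIdeal (vanishingIdeal (⟨closure {η}, isClosed_closure⟩ : Closeds X)) y)) ∧
          (∀ (X₉ : Scheme.{0}) (π : X₉ ⟶ X), IsBlowup π (vanishingIdeal (⟨closure {η}, isClosed_closure⟩ : Closeds X)) →
            ∀ x' : X₉, IsClosed ({x'} : Set X₉) → π x' ∈ closure ({η} : Set X) →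
              idealOrder (controlledTransform π (vanishingIdeal (⟨closure {η}, isClosed_closure⟩ : Closeds X)) J m) x' = m →
              (maximalIdeal (X₉.presheaf.stalk x')).spanFinrank = 3 →
              ∀ hr : IsRegularLocalRing (X₉.presheaf.stalk x'),
                2 ≤ @stalkTau X₉ (controlledTransform π (vanishingIdeal (⟨closure {η}, isClosed_closure⟩ : Closeds X)) J m) x' hr m)) →
      -- (min) `λ` does not drop along any clean-permissible sequence reaching a curve situation
      (∀ (X₁ : Scheme.{0}) [IsIntegral X₁] (Φ : X₁ ⟶ X) [IsDominant Φ] (J₁ : X₁.IdealSheafData),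
        IsCleanPermissibleSeq p Φ J m J₁ G → ∀ η₁ : X₁,
        ¬ IsClosed ({η₁} : Set X₁) →
        Scheme.IsRegular (vanishingIdeal (⟨closure {η₁}, isClosed_closure⟩ : Closeds X₁)).subscheme →
        (∀ z : X₁, (m : ℕ∞) ≤ idealOrder J₁ z → z ∈ closure ({η₁} : Set X₁)) →
        (∀ y ∈ closure ({η₁} : Set X₁), idealOrder J₁ y = m) →
        (Module.length (X.presheaf.stalk η) (X.presheaf.stalk η ⧸ stalkIdeal J η)).toNat ≤
          (Module.length (X₁.presheaf.stalk η₁) (X₁.presheaf.stalk η₁ ⧸ stalkIdeal J₁ η₁)).toNat) →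
      ∃ (X' : Scheme.{0}) (π : X' ⟶ X) (_ : IsIntegral X') (_ : IsDominant π) (J' : X'.IdealSheafData),
        IsCleanPermissibleSeq p π J m J' G ∧ ∀ x, idealOrder J' x < m) :
    ∃ (X' : Scheme.{0}) (π : X' ⟶ X) (_ : IsIntegral X') (_ : IsDominant π) (J' : X'.IdealSheafData),
      IsCleanPermissibleSeq p π J m J' G ∧ ∀ x, idealOrder J' x < m := by
  classical
  -- the invariants at every reachable stage (over the forgetful map to the W4.6 currency)
  have inv := fun {X₁ : Scheme.{0}} [IsIntegral X₁] {Φ : X₁ ⟶ X} [IsDominant Φ] {J₁ : X₁.IdealSheafData}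
      (h : IsCleanPermissibleSeq p Φ J m J₁ G) =>
    IsPermissibleBlowupSeq.prop44Invariants hX hqe hm hle hcodim (isPermissibleBlowupSeq_of_isPermissibleSeq h.isPermissibleSeq)
  -- ONE STEP at a reachable curve situation: the answer, or a reachable curve situation of smaller `λ`
  have step : ∀ (X₁ : Scheme.{0}) [IsIntegral X₁] (Φ : X₁ ⟶ X) [IsDominant Φ] (J₁ : X₁.IdealSheafData),
      IsCleanPermissibleSeq p Φ J m J₁ G → ∀ (η₁ : X₁),
      Scheme.IsRegular (vanishingIdeal (⟨closure {η₁}, isClosed_closure⟩ : Closeds X₁)).subscheme →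
      (∀ z : X₁, (m : ℕ∞) ≤ idealOrder J₁ z → z ∈ closure ({η₁} : Set X₁)) →
      (∀ y ∈ closure ({η₁} : Set X₁), idealOrder J₁ y = m) → Order.coheight η₁ = 2 →
      (∃ (X' : Scheme.{0}) (π : X' ⟶ X) (_ : IsIntegral X') (_ : IsDominant π) (J' : X'.IdealSheafData),
          IsCleanPermissibleSeq p π J m J' G ∧ ∀ x, idealOrder J' x < m) ∨
      (∃ (X₂ : Scheme.{0}) (_ : IsIntegral X₂) (Φ₂ : X₂ ⟶ X) (_ : IsDominant Φ₂) (J₂ : X₂.IdealSheafData) (η₂ : X₂),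
          IsCleanPermissibleSeq p Φ₂ J m J₂ G ∧
          Scheme.IsRegular (vanishingIdeal (⟨closure {η₂}, isClosed_closure⟩ : Closeds X₂)).subscheme ∧
          (∀ z : X₂, (m : ℕ∞) ≤ idealOrder J₂ z → z ∈ closure ({η₂} : Set X₂)) ∧
          (∀ y ∈ closure ({η₂} : Set X₂), idealOrder J₂ y = m) ∧ Order.coheight η₂ = 2 ∧
          (Module.length (X₂.presheaf.stalk η₂) (X₂.presheaf.stalk η₂ ⧸ stalkIdeal J₂ η₂)).toNat <
            (Module.length (X₁.presheaf.stalk η₁) (X₁.presheaf.stalk η₁ ⧸ stalkIdeal J₁ η₁)).toNat) := by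
    intro X₁ _ Φ _ J₁ hseq η₁ hYreg₁ hstr₁ hord₁ hcoh₁
    obtain ⟨-, hnoeth₁, hX₁, hqe₁, hle₁, hcodim₁⟩ := inv hseq
    haveI := hnoeth₁
    have hX3₁ : topologicalKrullDim X₁ ≤ 3 :=
      (isPermissibleBlowupSeq_of_isPermissibleSeq hseq.isPermissibleSeq).topologicalKrullDim_le inferInstance hX3
    have hcoh3 : ∀ z : X₁, Order.coheight z ≤ 3 := (topologicalKrullDim_le_iff_forall_coheight_le X₁ 3).mp hX3₁
    haveI hcharX₁ : CharP X₁.functionField p := charP_of_injective_ringHom (RatFn.functionFieldMap Φ).injective p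
    -- the line stays clean-regular at every point of the stage
    have hG₁ : ∀ x : X₁, CleanRegAt p (algebraMap (X₁.presheaf.stalk x) X₁.functionField) (RatFn.functionFieldMap Φ G) :=
      hseq.cleanRegAt hp hcharX hG
    -- composition of an answer over `X₁` with the sequence reaching `X₁`
    have finish : (∃ (X' : Scheme.{0}) (π : X' ⟶ X₁) (_ : IsIntegral X') (_ : IsDominant π) (J' : X'.IdealSheafData),
        IsCleanPermissibleSeq p π J₁ m J' (RatFn.functionFieldMap Φ G) ∧ ∀ x, idealOrder J' x < m) →
        ∃ (X' : Scheme.{0}) (π : X' ⟶ X) (_ : IsIntegral X') (_ : IsDominant π) (J' : X'.IdealSheafData),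
          IsCleanPermissibleSeq p π J m J' G ∧ ∀ x, idealOrder J' x < m := by
      intro h
      obtain ⟨X', π, hX', hπ, J', hseq', hlt⟩ := h
      haveI := hX'
      haveI := hπ
      exact ⟨X', π ≫ Φ, inferInstance, inferInstance, J', hseq.comp hseq' rfl, hlt⟩
    -- (o) a degenerate situation: `η₁` is a closed point — an isolated coheight-2 point of the stratum
    by_cases hcl : IsClosed ({η₁} : Set X₁)
    · left
      apply finish
      haveI hne : Nonempty ((⊤ : X₁.Opens) : Scheme.{0}) := ⟨⟨η₁, trivial⟩⟩
      haveI : IsIntegral ((⊤ : X₁.Opens) : Scheme.{0}) := isIntegral_of_isOpenImmersion (⊤ : X₁.Opens).ι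
      haveI : IsDominant (⊤ : X₁.Opens).ι := isDominant_of_isOpenImmersion (⊤ : X₁.Opens).ι
      have hbad : ∀ z : X₁, (m : ℕ∞) ≤ idealOrder J₁ z → z = η₁ ∨ z ∉ ((⊤ : X₁.Opens) : Set X₁) := fun z hz => by
        left
        have h1 := hstr₁ z hz
        rw [hcl.closure_eq] at h1
        exact h1
      have hordη : idealOrder J₁ η₁ = m := hord₁ η₁ (subset_closure (Set.mem_singleton η₁))
      exact exists_isCleanPermissibleSeq_lt_of_top J₁ m (RatFn.functionFieldMap Φ G)
        (exists_isCleanPermissibleSeq_lt_comap_of_isolated_coheight_two hp hX₁ J₁ hm hle₁ hcodim₁ (RatFn.functionFieldMap Φ G) hG₁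
          ⊤ η₁ trivial hcl hbad hordη hcoh₁)
    -- (a) the `τ ≥ 2` regime
    by_cases hτ2 : (∀ x : X₁, IsClosed ({x} : Set X₁) → idealOrder J₁ x = m → (maximalIdeal (X₁.presheaf.stalk x)).spanFinrank = 3 →
          ∀ hr : IsRegularLocalRing (X₁.presheaf.stalk x), 2 ≤ @stalkTau X₁ J₁ x hr m)
    · left
      exact finish (exists_isCleanPermissibleSeq_lt_of_two_le_stalkTau hp hX₁ hqe₁ hX3₁ (RatFn.functionFieldMap Φ G) hG₁ J₁ hm
        hle₁ hcodim₁ hτ2)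
    -- (b) the curve is clean-permissible at each of its points and has no very near point
    by_cases hcpvn : ((∀ y ∈ closure ({η₁} : Set X₁), CleanPermissibleAt p (algebraMap (X₁.presheaf.stalk y) X₁.functionField) (RatFn.functionFieldMap Φ G)
            (stalkIdeal (vanishingIdeal (⟨closure {η₁}, isClosed_closure⟩ : Closeds X₁)) y)) ∧
          (∀ (X₉ : Scheme.{0}) (π : X₉ ⟶ X₁), IsBlowup π (vanishingIdeal (⟨closure {η₁}, isClosed_closure⟩ : Closeds X₁)) →
            ∀ x' : X₉, IsClosed ({x'} : Set X₉) → π x' ∈ closure ({η₁} : Set X₁) →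
              idealOrder (controlledTransform π (vanishingIdeal (⟨closure {η₁}, isClosed_closure⟩ : Closeds X₁)) J₁ m) x' = m →
              (maximalIdeal (X₉.presheaf.stalk x')).spanFinrank = 3 →
              ∀ hr : IsRegularLocalRing (X₉.presheaf.stalk x'),
                2 ≤ @stalkTau X₉ (controlledTransform π (vanishingIdeal (⟨closure {η₁}, isClosed_closure⟩ : Closeds X₁)) J₁ m) x' hr m))
    · left
      apply finish
      have hoff : ∀ x : X₁, x ∉ ((⟨closure {η₁}, isClosed_closure⟩ : Closeds X₁) : Set X₁) → IsClosed ({x} : Set X₁) →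
          idealOrder J₁ x = m → (maximalIdeal (X₁.presheaf.stalk x)).spanFinrank = 3 →
          ∀ hr : IsRegularLocalRing (X₁.presheaf.stalk x), 2 ≤ @stalkTau X₁ J₁ x hr m := by
        intro x hx _ hordx _ _
        exact absurd (hstr₁ x (by rw [hordx])) hx
      exact exists_isCleanPermissibleSeq_lt_of_two_le_stalkTau_off_centre hp hX₁ hqe₁ hX3₁ (RatFn.functionFieldMap Φ G) hG₁ J₁ hm
        hle₁ hcodim₁ ⟨closure {η₁}, isClosed_closure⟩ (isIntegral_subscheme_closure η₁) hYreg₁ hord₁ hcpvn.1 hcpvn.2 hoff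
    -- (c) a clean-permissible detour to a curve situation of smaller `λ`: recurse
    by_cases hdrop : ∃ (X₂ : Scheme.{0}) (_ : IsIntegral X₂) (Φ₂ : X₂ ⟶ X₁) (_ : IsDominant Φ₂) (J₂ : X₂.IdealSheafData) (η₂ : X₂),
        IsCleanPermissibleSeq p Φ₂ J₁ m J₂ (RatFn.functionFieldMap Φ G) ∧ ¬ IsClosed ({η₂} : Set X₂) ∧
        Scheme.IsRegular (vanishingIdeal (⟨closure {η₂}, isClosed_closure⟩ : Closeds X₂)).subscheme ∧
        (∀ z : X₂, (m : ℕ∞) ≤ idealOrder J₂ z → z ∈ closure ({η₂} : Set X₂)) ∧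
        (∀ y ∈ closure ({η₂} : Set X₂), idealOrder J₂ y = m) ∧
        (Module.length (X₂.presheaf.stalk η₂) (X₂.presheaf.stalk η₂ ⧸ stalkIdeal J₂ η₂)).toNat <
          (Module.length (X₁.presheaf.stalk η₁) (X₁.presheaf.stalk η₁ ⧸ stalkIdeal J₁ η₁)).toNat
    · right
      obtain ⟨X₂, hX₂, Φ₂, hΦ₂, J₂, η₂, hseq₂, hcl₂, hYreg₂, hstr₂, hord₂, hlt⟩ := hdrop
      haveI := hX₂
      haveI := hΦ₂
      have hseq₂' : IsCleanPermissibleSeq p (Φ₂ ≫ Φ) J m J₂ G := hseq.comp hseq₂ rfl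
      -- `codim η₂ = 2` at the new stage
      obtain ⟨-, hnoeth₂, -, -, -, hcodim₂⟩ := inv hseq₂'
      haveI := hnoeth₂
      have hX3₂ : topologicalKrullDim X₂ ≤ 3 :=
        (isPermissibleBlowupSeq_of_isPermissibleSeq hseq₂'.isPermissibleSeq).topologicalKrullDim_le inferInstance hX3
      have hcoh3₂ : ∀ z : X₂, Order.coheight z ≤ 3 := (topologicalKrullDim_le_iff_forall_coheight_le X₂ 3).mp hX3₂
      have hsupp₂ : η₂ ∈ J₂.support := by
        rw [← one_le_idealOrder_iff, hord₂ η₂ (subset_closure (Set.mem_singleton η₂))]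
        exact_mod_cast hm
      have hcoh₂ : Order.coheight η₂ = 2 := coheight_eq_two_of_not_isClosed hcoh3₂ (hcodim₂ _ hsupp₂) hcl₂
      exact ⟨X₂, inferInstance, Φ₂ ≫ Φ, inferInstance, J₂, η₂, hseq₂', hYreg₂, hstr₂, hord₂, hcoh₂, hlt⟩
    -- (d) a (R3ᵐⁱⁿ) situation: the hypothesis, applied to the transform of `G`, then composition
    left
    apply finish
    have hmin : (∀ (X₂ : Scheme.{0}) [IsIntegral X₂] (Φ₂ : X₂ ⟶ X₁) [IsDominant Φ₂] (J₂ : X₂.IdealSheafData),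
          IsCleanPermissibleSeq p Φ₂ J₁ m J₂ (RatFn.functionFieldMap Φ G) → ∀ η₂ : X₂,
          ¬ IsClosed ({η₂} : Set X₂) →
          Scheme.IsRegular (vanishingIdeal (⟨closure {η₂}, isClosed_closure⟩ : Closeds X₂)).subscheme →
          (∀ z : X₂, (m : ℕ∞) ≤ idealOrder J₂ z → z ∈ closure ({η₂} : Set X₂)) →
          (∀ y ∈ closure ({η₂} : Set X₂), idealOrder J₂ y = m) →
          (Module.length (X₁.presheaf.stalk η₁) (X₁.presheaf.stalk η₁ ⧸ stalkIdeal J₁ η₁)).toNat ≤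
            (Module.length (X₂.presheaf.stalk η₂) (X₂.presheaf.stalk η₂ ⧸ stalkIdeal J₂ η₂)).toNat) := by
      intro X₂ _ Φ₂ _ J₂ hseq₂ η₂ hcl₂ hYreg₂ hstr₂ hord₂
      by_contra hlt
      exact hdrop ⟨X₂, inferInstance, Φ₂, inferInstance, J₂, η₂, hseq₂, hcl₂, hYreg₂, hstr₂, hord₂, lt_of_not_ge hlt⟩
    exact hMIN hcharX₁ hX₁ hqe₁ hX3₁ (RatFn.functionFieldMap Φ G) hG₁ J₁ hle₁ hcodim₁ η₁ hcl hYreg₁ hstr₁ hord₁ hτ2 hcpvn hmin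
  -- STRONG INDUCTION on `λ` over the reachable curve situations
  have key : ∀ (n : ℕ) (X₁ : Scheme.{0}) [IsIntegral X₁] (Φ : X₁ ⟶ X) [IsDominant Φ] (J₁ : X₁.IdealSheafData),
      IsCleanPermissibleSeq p Φ J m J₁ G → ∀ (η₁ : X₁),
      Scheme.IsRegular (vanishingIdeal (⟨closure {η₁}, isClosed_closure⟩ : Closeds X₁)).subscheme →
      (∀ z : X₁, (m : ℕ∞) ≤ idealOrder J₁ z → z ∈ closure ({η₁} : Set X₁)) →
      (∀ y ∈ closure ({η₁} : Set X₁), idealOrder J₁ y = m) → Order.coheight η₁ = 2 →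
      (Module.length (X₁.presheaf.stalk η₁) (X₁.presheaf.stalk η₁ ⧸ stalkIdeal J₁ η₁)).toNat ≤ n →
      ∃ (X' : Scheme.{0}) (π : X' ⟶ X) (_ : IsIntegral X') (_ : IsDominant π) (J' : X'.IdealSheafData),
        IsCleanPermissibleSeq p π J m J' G ∧ ∀ x, idealOrder J' x < m := by
    intro n
    induction n with
    | zero =>
      intro X₁ _ Φ _ J₁ hseq η₁ hYreg₁ hstr₁ hord₁ hcoh₁ hΛ
      rcases step X₁ Φ J₁ hseq η₁ hYreg₁ hstr₁ hord₁ hcoh₁ with hdone | ⟨X₂, hX₂, Φ₂, hΦ₂, J₂, η₂, -, -, -, -, -, hlt⟩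
      · exact hdone
      · exfalso
        omega
    | succ n ih =>
      intro X₁ _ Φ _ J₁ hseq η₁ hYreg₁ hstr₁ hord₁ hcoh₁ hΛ
      rcases step X₁ Φ J₁ hseq η₁ hYreg₁ hstr₁ hord₁ hcoh₁ with hdone | ⟨X₂, hX₂, Φ₂, hΦ₂, J₂, η₂, hseq₂, hYreg₂, hstr₂, hord₂, hcoh₂, hlt⟩
      · exact hdone
      · haveI := hX₂
        haveI := hΦ₂
        exact ih X₂ Φ₂ J₂ hseq₂ η₂ hYreg₂ hstr₂ hord₂ hcoh₂ (by omega)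
  exact key _ X (𝟙 X) J (IsCleanPermissibleSeq.nil J m G) η hYreg hstr hord hcoh le_rfl

end Summit.ResolutionOfSingularities.ResolutionOfSingularities.Theorems.RadicialJung.CleanModels

end
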